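/-
Copyright: b2b-lace packet (explicit-unit carver, gen 18).  The tail term of the general-cut weighted-bubble
skeleton, `(2dp)^{M+1} ℋ^{1,M+1}_p(0)`, under the BOOTSTRAP HYPOTHESIS `f₃(p) ≤ Γ₃` of a finite diagram family
containing the singleton-carried weighted diagram `(1, M+1, {0})`: it is at most `(2dp)^{M+1} Γ₃ c_{(1,M+1,{0})}`.
Oracle-level API for the composite (WBX-family) cell; no numerals, no dimension, nothing of the record touched.
-/
import Literature.Probability.FitznerVanDerHofstad2017.NobleInstantiateFamily
import Literature.Probability.FitznerVanDerHofstad2017.WeightedBubbleSkeletonSubcritical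
import HarnessLib

/-!
# The weighted-bubble skeleton under the bootstrap hypothesis `f₃ ≤ Γ₃`

CITATION HEADER (PLACEMENT v2). This module is part of a certified REPRODUCTION of:
R. Fitzner, R. van der Hofstad, *Mean-field behavior for nearest-neighbor percolation in d > 10*,
Electron. J. Probab. 22 (2017), no. 43, 1–65 [FvdH17], and *Generalized approach to the non-backtracking
lace expansion*, Probab. Theory Related Fields 169 (2017), 1041–1119 [NoBLE17-I] (arXiv:1506.07977, 1506.07969).
Reproduces: [NoBLE17-I] §2.2 (2.7)/(2.9) read on the hypothesis side — "`f₃(z) ≤ Γ₃` … so that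
`sup_{x ∈ S} ℋ^{n,l}_z(x) ≤ Γ₃ c_{n,l,S}` for every `(n,l,S) ∈ 𝒮`" (§3.3, proof of Prop. 3.6: the bounds on
the coefficients are "computed under the assumption `f_i(z) ≤ Γ_i`") — combined with §5.3.3 last paragraph
("we use `x_i − x ∈ S` with `S = {0}`") and §5.3.1 (5.38) iterated (the tree's `WeightedBubbleSkeleton`),
for a GENERAL finite index family `𝒮 : ι → ℕ × ℕ × Set ℤ^d` (`NobleInstantiateFamily`) one of whose members is the
singleton-carried diagram `(1, M+1, {0})` — in particular the seven-member family
`nobleTripleSnoc d (1, M+1, {0})` of the composite weighted-bubble cell.  Origin: build `lace`, node N67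
(oracle-level half N67-O; typer checklist items T1/T3 of the packet's `N67-INSTANCE-CHECK.md`) of `LEMMAS.md`.

## What is here (all `d`-generic; no numerals)

* `nobleSupH_singleton` — `sup_{x ∈ {x₀}} ℋ^{n,l}_p(x) = ℋ^{n,l}_p(x₀)`;
* `nobleSupH_div_le_nobleF3Of`, `nobleSupH_le_mul_of_nobleF3Of_le`, `nobleWeightedDiagramBoundOf_of_nobleF3Of_le`
  — the hypothesis side of (2.7): `f₃(p) ≤ γ` and `c > 0` give `sup_{x ∈ S_k} ℋ^{n_k,l_k}_p(x) ≤ γ c_k` for every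
  member `k`, i.e. `NobleWeightedDiagramBoundOf 𝒮 p (γ • c)`; `nobleH_le_mul_of_nobleF3Of_le` — for a member
  `𝒮 k = (n, l, {x₀})`, `ℋ^{n,l}_p(x₀) ≤ γ c_k`; `NobleWeightedDiagramBoundOf.nobleH_le_of_eq_singleton` /
  `.nobleH_le_of_snoc` — the conclusion side for a singleton-carried member;
* `tsum_sq_weighted_repBubble_le_skeleton_tau_of_nobleF3Of_le` — for `d ≥ 2`, `p < p_c`, a finite family `𝒮`
  with `𝒮 k = (1, M+1, {0})`, positive constants `c` and `f₃^{𝒮}(p) ≤ γ`: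
  `Σ_y ‖y‖₂² P_p({0 ←m→ y} ∘ {y ↔ 0}) ≤ Σ_{i=m}^{M} p^i Σ_{u ∈ SAW_i} ‖u(i)‖₂² τ_p(u(i)) + (2dp)^{M+1} γ c_k`
  (the coded tail of the WBX(M) cell: `(2d z)^{M+1} Γ₃ c_{(1,M+1,{0})}`), and its seven-family instance
  `tsum_sq_weighted_repBubble_le_skeleton_tau_snoc_of_nobleF3Of_le` (`𝒮 = nobleTripleSnoc d (1, M+1, {0})`,
  `k = Fin.last 6`), plus the `Fin 3`-family form `…_of_nobleFOf_le` reading the hypothesis as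
  `∀ i, nobleFOf 𝒮 cμ c i p ≤ Γ i` exactly as `NobleImprovementInputsOf` states it.

## What is NOT here

No value of `Γ₃`, `c`, `M`; no dimension; no claim about the explicit pieces `i ≤ M` beyond the tree's skeleton;
the record (`NobleInstantiate`, `NobleAssumptions`, `MeanFieldD11Cert`) is untouched.  No cited fact, no named
hypothesis, no `sorry`.

## References
* [NoBLE17-I] R. Fitzner, R. van der Hofstad, Generalized approach to the non-backtracking lace expansion,
  Probab. Theory Relat. Fields 169 (2017) 1041–1119; arXiv:1506.07969 — (2.7), (2.9), §3.3 (proof of Prop. 3.6),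
  §5.3.1 (5.38), §5.3.3 last paragraph.
* [FvdH17] R. Fitzner, R. van der Hofstad, Mean-field behavior for nearest-neighbor percolation in `d > 10`,
  Electron. J. Probab. 22 (2017) no. 43; arXiv:1506.07977v2 — (2.21), (2.23), §4.2.
-/

noncomputable section

namespace Literature.Probability.FitznerVanDerHofstad2017

open _root_.MeasureTheory Literature.Barriers.CriticalPhenomena Literature.Probability.Percolation
open Literature.Probability.LatticeModels
open scoped BigOperators ENNReal

variable {d : ℕ} {ι : Type*}

/-! ### Singleton-carried weighted diagrams -/

/-- `sup_{x ∈ {x₀}} ℋ^{n,l}_p(x) = ℋ^{n,l}_p(x₀)`. [folklore] -/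
@[simp] theorem nobleSupH_singleton (n l : ℕ) (x₀ : Site d) (p : unitInterval) :
    nobleSupH d n l {x₀} p = nobleH d n l p x₀ := by
  rw [nobleSupH, ciSup_unique]
  rfl

/-- Conclusion side, singleton member: a weighted-diagram bound for a family whose member `k` is
`(n, l, {x₀})` bounds `ℋ^{n,l}_p(x₀)` by `b_k`. [cite: FitznerVanDerHofstad2016NoBLE, (2.7) and §5.3.3 ("S = {0}")] -/
theorem NobleWeightedDiagramBoundOf.nobleH_le_of_eq_singleton {𝒮 : ι → ℕ × ℕ × Set (Site d)}
    {p : unitInterval} {b : ι → ℝ} (h : NobleWeightedDiagramBoundOf 𝒮 p b) {k : ι} {n l : ℕ}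
    {x₀ : Site d} (hk : 𝒮 k = (n, l, {x₀})) : nobleH d n l p x₀ ≤ b k := by
  have := h k
  rwa [hk, nobleSupH_singleton] at this

/-- Conclusion side for the seven-member family `nobleTripleSnoc d (n, l, {x₀})`: `ℋ^{n,l}_p(x₀) ≤ b₆`.
[cite: FitznerVanDerHofstad2016NoBLE, (2.7) and §5.3.3 ("S = {0}")] -/
theorem NobleWeightedDiagramBoundOf.nobleH_le_of_snoc {n l : ℕ} {x₀ : Site d} {p : unitInterval}
    {b : Fin 7 → ℝ} (h : NobleWeightedDiagramBoundOf (nobleTripleSnoc d (n, l, {x₀})) p b) :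
    nobleH d n l p x₀ ≤ b (Fin.last 6) :=
  h.nobleH_le_of_eq_singleton (nobleTripleSnoc_last (n, l, {x₀}))

/-! ### The hypothesis side of (2.7): `f₃ ≤ γ` gives per-diagram bounds `γ c_k` -/

section Family

variable [Fintype ι] [Nonempty ι]

/-- Each member's quotient is at most `f₃`: `sup_{x ∈ S_k} ℋ^{n_k,l_k}_p(x) / c_k ≤ f₃^{𝒮}(p)`.
[cite: FitznerVanDerHofstad2016NoBLE, (2.7)] -/
theorem nobleSupH_div_le_nobleF3Of (𝒮 : ι → ℕ × ℕ × Set (Site d)) (c : ι → ℝ) (p : unitInterval)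
    (k : ι) : nobleSupH d (𝒮 k).1 (𝒮 k).2.1 (𝒮 k).2.2 p / c k ≤ nobleF3Of 𝒮 c p :=
  Finset.le_sup' (fun i => nobleSupH d (𝒮 i).1 (𝒮 i).2.1 (𝒮 i).2.2 p / c i) (Finset.mem_univ k)

/-- **Hypothesis side of (2.7).** If `c > 0` and `f₃^{𝒮}(p) ≤ γ` then
`sup_{x ∈ S_k} ℋ^{n_k,l_k}_p(x) ≤ γ c_k` for every member `k`.
[cite: FitznerVanDerHofstad2016NoBLE, (2.7), (2.9) and §3.3 (proof of Prop. 3.6: "computed under the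
assumption f_i(z) ≤ Γ_i")] -/
theorem nobleSupH_le_mul_of_nobleF3Of_le {𝒮 : ι → ℕ × ℕ × Set (Site d)} {c : ι → ℝ}
    (hc : ∀ k, 0 < c k) {p : unitInterval} {γ : ℝ} (h : nobleF3Of 𝒮 c p ≤ γ) (k : ι) :
    nobleSupH d (𝒮 k).1 (𝒮 k).2.1 (𝒮 k).2.2 p ≤ γ * c k :=
  (div_le_iff₀ (hc k)).1 ((nobleSupH_div_le_nobleF3Of 𝒮 c p k).trans h)

/-- The same as a weighted-diagram bound with the bounds `b_k = γ c_k`.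
[cite: FitznerVanDerHofstad2016NoBLE, (2.7), (2.9)] -/
theorem nobleWeightedDiagramBoundOf_of_nobleF3Of_le {𝒮 : ι → ℕ × ℕ × Set (Site d)} {c : ι → ℝ}
    (hc : ∀ k, 0 < c k) {p : unitInterval} {γ : ℝ} (h : nobleF3Of 𝒮 c p ≤ γ) :
    NobleWeightedDiagramBoundOf 𝒮 p (fun k => γ * c k) :=
  fun k => nobleSupH_le_mul_of_nobleF3Of_le hc h k

/-- Hypothesis side, singleton member: if `𝒮 k = (n, l, {x₀})`, `c > 0` and `f₃^{𝒮}(p) ≤ γ` then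
`ℋ^{n,l}_p(x₀) ≤ γ c_k`. [cite: FitznerVanDerHofstad2016NoBLE, (2.7) and §5.3.3 ("S = {0}")] -/
theorem nobleH_le_mul_of_nobleF3Of_le {𝒮 : ι → ℕ × ℕ × Set (Site d)} {c : ι → ℝ}
    (hc : ∀ k, 0 < c k) {p : unitInterval} {γ : ℝ} (h : nobleF3Of 𝒮 c p ≤ γ) {k : ι} {n l : ℕ}
    {x₀ : Site d} (hk : 𝒮 k = (n, l, {x₀})) : nobleH d n l p x₀ ≤ γ * c k :=
  (nobleWeightedDiagramBoundOf_of_nobleF3Of_le hc h).nobleH_le_of_eq_singleton hk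

/-! ### The skeleton's tail under `f₃ ≤ γ` -/

/-- **The weighted repulsive bubble under the bootstrap hypothesis.**  For `d ≥ 2`, `p < p_c`, a finite
diagram family `𝒮` with a member `𝒮 k = (1, M+1, {0})`, constants `c > 0` and `f₃^{𝒮}(p) ≤ γ`:
`Σ_y ‖y‖₂² P_p({0 ←m→ y} ∘ {y ↔ 0}) ≤ Σ_{i ∈ [m,M]} p^i Σ_{u ∈ SAW_i} ‖u(i)‖₂² τ_p(u(i)) + (2dp)^{M+1} γ c_k`
— the tree's skeleton (`tsum_sq_weighted_repBubble_le_skeleton_tau_of_subcritical`) with its tail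
`(2dp)^{M+1} ℋ^{1,M+1}_p(0)` bounded through `ℋ^{1,M+1}_p(0) ≤ γ c_k`.
[cite: FitznerVanDerHofstad2016NoBLE, §5.3.1 (5.38), §5.3.3 last paragraph, (2.7)/(2.9)]
[cite: FitznerVanDerHofstad2017, (2.21), §4.2 (4.3), (4.12)] -/
theorem tsum_sq_weighted_repBubble_le_skeleton_tau_of_nobleF3Of_le (hd : 2 ≤ d) {p : unitInterval}
    (hp : (p : ℝ) < criticalProb (zdGraph d) (0 : Site d)) (m M : ℕ)
    {𝒮 : ι → ℕ × ℕ × Set (Site d)} {c : ι → ℝ} (hc : ∀ k, 0 < c k) {γ : ℝ}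
    (h : nobleF3Of 𝒮 c p ≤ γ) {k : ι} (hk : 𝒮 k = (1, M + 1, {(0 : Site d)})) :
    ∑' y : Site d, ENNReal.ofReal (euclidNorm y ^ 2) *
        bondPercolation (zdGraph d) p (openConnGe m (0 : Site d) y □ openConn y 0) ≤
      (∑ i ∈ Finset.Icc m M, ENNReal.ofReal ((p : ℝ) ^ i) *
          ∑ u ∈ sawWords d i, ENNReal.ofReal (euclidNorm (wordPos u i) ^ 2) *
            ENNReal.ofReal (tau d p 0 (wordPos u i))) +
        ENNReal.ofReal ((2 * d * (p : ℝ)) ^ (M + 1) * (γ * c k)) := by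
  refine (tsum_sq_weighted_repBubble_le_skeleton_tau_of_subcritical hd hp m M).trans ?_
  gcongr
  · exact pow_nonneg (mul_nonneg (by positivity) (unitInterval.nonneg p)) _
  · exact nobleH_le_mul_of_nobleF3Of_le hc h hk

end Family

/-- **The seven-family instance** (`𝒮 = nobleTripleSnoc d (1, M+1, {0})`, the composite weighted-bubble
cell's diagram family; member `Fin.last 6`): for `d ≥ 2`, `p < p_c`, `c > 0`, `f₃(p) ≤ γ`,
`Σ_y ‖y‖₂² P_p({0 ←m→ y} ∘ {y ↔ 0}) ≤ Σ_{i ∈ [m,M]} p^i Σ_{u ∈ SAW_i} ‖u(i)‖₂² τ_p(u(i)) + (2dp)^{M+1} γ c₆`.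
[cite: FitznerVanDerHofstad2016NoBLE, §5.3.1 (5.38), §5.3.3 last paragraph, (2.7)/(2.9)]
[cite: FitznerVanDerHofstad2017, (2.21), (2.23), §4.2] -/
theorem tsum_sq_weighted_repBubble_le_skeleton_tau_snoc_of_nobleF3Of_le (hd : 2 ≤ d)
    {p : unitInterval} (hp : (p : ℝ) < criticalProb (zdGraph d) (0 : Site d)) (m M : ℕ)
    {c : Fin 7 → ℝ} (hc : ∀ k, 0 < c k) {γ : ℝ}
    (h : nobleF3Of (nobleTripleSnoc d (1, M + 1, {(0 : Site d)})) c p ≤ γ) :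
    ∑' y : Site d, ENNReal.ofReal (euclidNorm y ^ 2) *
        bondPercolation (zdGraph d) p (openConnGe m (0 : Site d) y □ openConn y 0) ≤
      (∑ i ∈ Finset.Icc m M, ENNReal.ofReal ((p : ℝ) ^ i) *
          ∑ u ∈ sawWords d i, ENNReal.ofReal (euclidNorm (wordPos u i) ^ 2) *
            ENNReal.ofReal (tau d p 0 (wordPos u i))) +
        ENNReal.ofReal ((2 * d * (p : ℝ)) ^ (M + 1) * (γ * c (Fin.last 6))) :=
  tsum_sq_weighted_repBubble_le_skeleton_tau_of_nobleF3Of_le hd hp m M hc h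
    (nobleTripleSnoc_last (1, M + 1, {(0 : Site d)}))

/-- **The same with the hypothesis read exactly as `NobleImprovementInputsOf` states it**: on the bootstrap
interval, `p ∈ (1/(2d-1), p_c)` and `∀ i, f_i(p) ≤ Γ_i` for the `Fin 3`-family `nobleFOf 𝒮 cμ c` of a finite
family with member `𝒮 k = (1, M+1, {0})` give the skeleton with tail `(2dp)^{M+1} Γ₃ c_k` (`Γ₃ = Γ 2`).
[cite: FitznerVanDerHofstad2016NoBLE, (2.7)/(2.9), §3.3, §5.3.1 (5.38), §5.3.3]
[cite: FitznerVanDerHofstad2017, (2.19)–(2.21), §4.2] -/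
theorem tsum_sq_weighted_repBubble_le_skeleton_tau_of_nobleFOf_le [Fintype ι] [Nonempty ι] (hd : 2 ≤ d)
    {p : unitInterval} (hp : p ∈ Set.Ioo (nbwThresholdI d) (criticalProbI d)) (m M : ℕ)
    {𝒮 : ι → ℕ × ℕ × Set (Site d)} {cμ : ℝ} {c : ι → ℝ} (hc : ∀ k, 0 < c k) {Γ : Fin 3 → ℝ}
    (hΓ : ∀ i, nobleFOf 𝒮 cμ c i p ≤ Γ i) {k : ι} (hk : 𝒮 k = (1, M + 1, {(0 : Site d)})) :
    ∑' y : Site d, ENNReal.ofReal (euclidNorm y ^ 2) *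
        bondPercolation (zdGraph d) p (openConnGe m (0 : Site d) y □ openConn y 0) ≤
      (∑ i ∈ Finset.Icc m M, ENNReal.ofReal ((p : ℝ) ^ i) *
          ∑ u ∈ sawWords d i, ENNReal.ofReal (euclidNorm (wordPos u i) ^ 2) *
            ENNReal.ofReal (tau d p 0 (wordPos u i))) +
        ENNReal.ofReal ((2 * d * (p : ℝ)) ^ (M + 1) * (Γ 2 * c k)) := by
  have hpc : (p : ℝ) < criticalProb (zdGraph d) (0 : Site d) := by
    rw [← coe_criticalProbI]
    exact Subtype.coe_lt_coe.2 hp.2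
  have h3 : nobleF3Of 𝒮 c p ≤ Γ 2 := by simpa only [nobleFOf_two] using hΓ 2
  exact tsum_sq_weighted_repBubble_le_skeleton_tau_of_nobleF3Of_le hd hpc m M hc h3 hk

end Literature.Probability.FitznerVanDerHofstad2017

end
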